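import Literature.RingTheory.FormalGroups.FormalOModuleLawLifting
import HarnessLib

/-!
# Crux `HLiu418` — P6 sub-line **F0-P6d LubinTateFormalModuli**, stub (c𝒪) `stub_L4B3cO : FormalOModuleLiftsAlongSurjection 𝒪 p` PAID

HC_CM is proved only modulo the printed citations until rung 0 closes.  Cell `hodgecm-mathlib`, P6 «MOD programme» Row 4B, line
`Cruxes/HLiu418/Lines/F0_P6d_LubinTateFormalModuli.lean` (F0P6d-plan (g0), ED. 2), registered stub (c𝒪) `stub_L4B3cO`: **formal
`𝒪`-module laws lift along surjections of `𝒪`-algebras, law and action JOINTLY** ([Drinfeld1974] §1 Prop. 1.4; [Hazewinkel1978]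
§21.4), `𝒪` a discrete valuation ring with finite residue field of characteristic `p`.

This file proves `formalOModuleLiftsAlongSurjection_holds`, whose statement is the body of `FormalOModuleLiftsAlongSurjection.{u, v} 𝒪 p`
BINDER FOR BINDER (nothing imports the Lines module), with the line-local `Prop`-structure `IsFormalOModuleLaw 𝒪 F ρ` (not
δ-unfoldable from here) replaced — in the hypothesis and in the conclusion — by the CONJUNCTION OF ITS SIX FIELDS in declaration order
(`isComm ∧ coeff_one ∧ map_one ∧ map_zero ∧ map_add ∧ map_mul`).  Fold (4 lines, anonymous-constructor reshuffle):
```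
theorem stub_L4B3cO 𝒪 p := fun hfin hchar hc A' A _ _ _ _ π hπ hn F ρ h => by
  obtain ⟨F', ρ', ⟨h₁, h₂, h₃, h₄, h₅, h₆⟩, hF, hρ⟩ := F0P6dStubL4B3cO.formalOModuleLiftsAlongSurjection_holds 𝒪 p hfin hchar hc
    A' A π hπ hn F ρ ⟨h.isComm, h.coeff_one, h.map_one, h.map_zero, h.map_add, h.map_mul⟩
  exact ⟨F', ρ', ⟨h₁, h₂, h₃, h₄, h₅, h₆⟩, hF, hρ⟩
```
Equivalently, with the bridge `IsFormalOModuleLaw 𝒪 F ρ ⟷ ★ FormalOModuleLaw 𝒪 A` (F0P3b-p01 (g9) snippet) the stub is ★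
`Literature.RingTheory.FormalGroups.FormalOModuleLaw.exists_map_eq` (`FormalOModuleLawLifting.lean`, road «universal formal
`𝒪`-module law over `𝒪[S]` by Hazewinkel's functional equation lemma + Drinfeld's rank-one cocycle lemma + degree induction»; TRIO),
which is also how this file proves it.  The letter's hypotheses «`𝒪` complete» and «`p` nilpotent in `A′`» are NOT used (idle
binders).  ONE THEOREM; no definition, no instance, no `sorry`; nothing here is about HC — it discharges one registered stub of the P6d line.

## References
* [Drinfeld1974] V. G. Drinfeld, *Elliptic modules*, Math. USSR-Sb. 23 (1974), §1 Prop. 1.4 (`Λ_𝒪 ≅ 𝒪[g₁, g₂, …]`).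
* [Hazewinkel1978] M. Hazewinkel, *Formal Groups and Applications* (1978), §2.2 (functional equation lemma), §21.4 (universal formal
  `A`-module).
* [HarrisTaylorAMS2001] M. Harris, R. Taylor, Ann. of Math. Stud. 151 (2001), proof of Lemma III.4.1 (p. 108) — the use: deformations
  of the one-dimensional formal `𝒪_{F,w}`-module `ε𝒜_s[w^∞]` are unobstructed.
-/

set_option autoImplicit false
set_option linter.dupNamespace false -- the mandated namespace repeats `HodgeConjecture.HodgeConjecture`

noncomputable section

namespace Summit.HodgeConjecture.HodgeConjecture.Cruxes.HLiu418.F0P6dStubL4B3cO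

universe u v

open Literature.RingTheory.FormalGroups

/-- **Stub (c𝒪) `stub_L4B3cO` PAID — the body of `FormalOModuleLiftsAlongSurjection.{u, v} 𝒪 p` binder for binder** (the
structure `IsFormalOModuleLaw` spelled as the conjunction of its six fields): for a discrete valuation ring `𝒪` with finite residue
field of characteristic `p`, every formal `𝒪`-module law `(F, ρ)` over an `𝒪`-algebra `A` lifts along every surjective `𝒪`-algebra
map `π : A′ ↠ A` to a formal `𝒪`-module law `(F′, ρ′)` over `A′` with `π_* F′ = F` and `π_* [a]_{F′} = [a]_F` for all `a`
(completeness of `𝒪` and `p`-nilpotence in `A′` are idle).  Proof: ★ `FormalOModuleLaw.exists_map_eq`.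
[cite: Drinfeld1974, §1 Prop. 1.4] [cite: Hazewinkel1978, §21.4] [cite: HarrisTaylorAMS2001, Lemma III.4.1 (p. 108)] -/
theorem formalOModuleLiftsAlongSurjection_holds (𝒪 : Type v) [CommRing 𝒪] [IsDomain 𝒪] [IsDiscreteValuationRing 𝒪]
    (p : ℕ) [Fact p.Prime] :
    Finite (IsLocalRing.ResidueField 𝒪) → CharP (IsLocalRing.ResidueField 𝒪) p → IsAdicComplete (IsLocalRing.maximalIdeal 𝒪) 𝒪 →
    ∀ (A' A : Type u) [CommRing A'] [CommRing A] [Algebra 𝒪 A'] [Algebra 𝒪 A] (π : A' →ₐ[𝒪] A), Function.Surjective π →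
      IsNilpotent (p : A') →
      ∀ (F : FormalGroup A) (ρ : 𝒪 → FormalGroupHom F F),
        (F.IsComm ∧ (∀ a, PowerSeries.coeff 1 (ρ a).toPowerSeries = algebraMap 𝒪 A a) ∧ ρ 1 = FormalGroupHom.id F ∧
          (ρ 0).toPowerSeries = 0 ∧
          (∀ a b, (ρ (a + b)).toPowerSeries =
            F.toPowerSeries.subst ![((ρ a).toPowerSeries : MvPowerSeries Unit A), (ρ b).toPowerSeries]) ∧
          ∀ a b, ρ (a * b) = (ρ a).comp (ρ b)) →
        ∃ (F' : FormalGroup A') (ρ' : 𝒪 → FormalGroupHom F' F'),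
          (F'.IsComm ∧ (∀ a, PowerSeries.coeff 1 (ρ' a).toPowerSeries = algebraMap 𝒪 A' a) ∧ ρ' 1 = FormalGroupHom.id F' ∧
            (ρ' 0).toPowerSeries = 0 ∧
            (∀ a b, (ρ' (a + b)).toPowerSeries =
              F'.toPowerSeries.subst ![((ρ' a).toPowerSeries : MvPowerSeries Unit A'), (ρ' b).toPowerSeries]) ∧
            ∀ a b, ρ' (a * b) = (ρ' a).comp (ρ' b)) ∧
          F'.map π.toRingHom = F ∧ ∀ a, PowerSeries.map π.toRingHom (ρ' a).toPowerSeries = (ρ a).toPowerSeries := by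
  intro hfin hchar _ A' A _ _ _ _ π hπ _ F ρ hFρ
  haveI := hfin
  haveI := hchar
  obtain ⟨h₁, h₂, h₃, h₄, h₅, h₆⟩ := hFρ
  -- bridge: the six axioms package `(F, ρ)` into a ★ `FormalOModuleLaw 𝒪 A` (F0P3b-p01's snippet, inlined)
  obtain ⟨M', hF, hact⟩ := FormalOModuleLaw.exists_map_eq p π hπ
    { toFormalGroup := F, isComm := h₁, act := ρ, coeff_one_act := h₂, act_zero := h₄, act_one := by rw [h₃]; rfl,
      act_add := h₅, act_mul := fun a b => by rw [h₆]; rfl }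
  exact ⟨M'.toFormalGroup, M'.act,
    ⟨M'.isComm, M'.coeff_one_act, M'.act_one', M'.act_zero, M'.act_add, M'.act_mul'⟩, hF, hact⟩

end Summit.HodgeConjecture.HodgeConjecture.Cruxes.HLiu418.F0P6dStubL4B3cO
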